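import Summits.BirchSwinnertonDyer.BirchSwinnertonDyer.Theses.SignedBaseChange
import Summits.BirchSwinnertonDyer.BirchSwinnertonDyer.Theorems.SignedBaseChangeAnticyclotomicEisensteinDivisibilityXGrTwoModuleFinite
import Summits.BirchSwinnertonDyer.BirchSwinnertonDyer.Theorems.SignedBaseChangeAnticyclotomicEisensteinDivisibilitySpecializationS2
import Literature.NumberTheory.EllipticCurves.TwoVariableAnticyclotomicControl
import Literature.NumberTheory.EllipticCurves.YanZhu2026.GreenbergMainTheoremsAnyRoot
import HarnessLib

/-!
# Line `torsplice` (sub-skeleton, UNREGISTERED — W-79: the skeleton of record on stmt-…-20727 is the LEAD's `bdpline` v8)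
# for crux `AnticyclotomicEisensteinDivisibility` (stmt-BirchSwinnertonDyer-20727), route `SignedBaseChange`.
# Author: ideator seat bsd-idea-14 (g2), 2026-08-28. BSD is not proved by this file.

TARGET (verbatim): the text of `Bdpline.stub_torsionSS` (bdpline v8, tree `Lines/bdpline.lean` :82) —
`X_Gr₂ = X_Gr(E/K̃_∞)` is a TORSION `Λ₂`-module at a good supersingular `p ≥ 5` (`a_p = 0`), `Surj`, Heegner `K`, ANY `N`.
Under the staged rev 17-SS restate this text is (i) the HYPOTHESIS `Module.IsTorsion Λ₂ X_Gr₂` of the new AC child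
`AnticyclotomicEisensteinDivisibilityRatSS` and (ii) the FIRST CONJUNCT of the new ES child `TwoVariableEulerSystemDivisibilityRatSS`;
so this splice discharges (i)/(ii) modulo its two stubs. It is the typed form of the LEAD's census roadmap (census-20727-gen0 v2.1,
`stub_torsionSS` bullet: "X_Gr₂ Λ₂-torsion ⟸ (i) X_ac Λ_ac-torsion + (ii) ker(X_Gr₂/T₁ → X_ac) Λ_ac-torsion + (iii) rank lemma (PROVED)"),
with (ii) SHARPENED to EXACT CONTROL (kernel = 0) — see `stub_exactControlSS`.

THE TWO STUBS
* `stub_xAcTorsionSS` (ARITHMETIC INPUT, one variable): `X_ac = XAc (E/K) p κ₂ v̄ ∅ γ₂` (dual of the v-relaxed / v̄-unramified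
  Selmer group over the anticyclotomic tower) is `Λ_ac`-torsion. TEXT = the torsion hypothesis clause of bdpline v8's
  `stub_bdpLowerHalfExistsSS` VERBATIM (so this stub alone also feeds S1-v8's hypothesis). Print: Castella–Wan, Math. Ann. 389 (2024)
  (= arXiv:1607.02019) §5.4 Thm 5.12 / Thm 4.3 proof (p > 3, big image; `𝔛^{rel,str}` torsion derived inside the proof);
  Castella–Çiperiani–Skinner–Sprung arXiv:1804.10993 Lemma 5.5 + Thm 5.7 (PRE; tree `…CastellaCiperianiSkinnerSprung2018.AnticyclotomicHowardDivisibilityOPEN`,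
  conjunct `Module.IsTorsion (IwasawaAlgebra p) (AcSelmer.XAc …)` under `GoodSS`, classical Heegner, ANY `N`); Kobayashi–Ota ASPM 86 (2020) (acq-07292,
  unheld; square-free `N` disputed among citers — w2 report torsion-in-print-20727-w2.md). STATUS (v1.2, after reading the MS): REFEREED PRINT for ANY `N⁺` —
  Castella–Wan Math. Ann. 389 (2024) Lemma 5.11 (p.20: `Sel^{ε,ε}` of `Λ_ac`-rank 1 ⇒ `𝔛^{rel,str}(K,𝐀^{ac})` is `Λ_ac`-torsion, with the
  prime-by-prime length formula) + Thm 5.12 (p.21: rank 1, under `G_K ↠ Aut_{ℤ_p}(T)`, `E[p]` ramified at `ℓ ∣ N⁻` — vacuous for `N⁻ = 1` — and the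
  standing (Heeg): `N⁺` divisible only by split primes, NO square-freeness; square-free `N` enters only the two-variable §4 / Thm on p.4). Remaining
  typing gap: CW's strict condition at `𝔭̄` vs the tree's Greenberg/unramified one — equal at supersingular `p` (no `p`-power torsion over
  `ℚ_p^{ab}ℚ_p^{nr}`). Why it might fail: it should not; the risk is only the object dictionary (`𝔛^{rel,str}(K,𝐀^{ac})` ↔ `AcSelmer.XAc … ∅`).
* `stub_exactControlSS` (GALOIS COHOMOLOGY, provable, L-sized): the canonical control map `toXAcQuot : X_Gr₂ ⧸ T₁X_Gr₂ → X_ac`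
  (tree `TwoVariableAnticyclotomicControl`, SURJECTIVE by `toXAcQuot_surjective` p567002 from `E(K)[p] = 0`) is INJECTIVE at a good
  SUPERSINGULAR prime — i.e. restriction `Sel_ac(K_∞⁻) → Sel(K̃_∞)^{γ₁=1}` is SURJECTIVE. Proof sketch (why the kernel is ZERO, not merely
  torsion): (a) global column `H¹(H_ac, M) → H¹(H̃, M)^{⟨γ₁⟩}` is onto because the next term of inflation–restriction is
  `H²(H_ac/H̃, M^{H̃})` and `M^{H̃} = E(K̃_∞)[p^∞] = 0` (`E(K)[p] = 0`, `Gal(K̃_∞/K)` pro-`p`); (b) local kernels vanish: at `w ∤ p`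
  the tree's conditions are INERTIA conditions and `I_w ∩ H̃ = I_w ∩ H_ac` (`K̃_∞/K_∞⁻` unramified outside `p`), so the local restriction is the
  identity; at `v` there is no condition; at `v̄` the kernel is `H¹(·, M^{H̃ ∩ I_v̄})` and `M^{H̃ ∩ I_v̄} ⊆ E(ℚ_p^{ab}·ℚ_p^{nr})[p^∞] = 0` for
  SUPERSINGULAR reduction (`Ẽ(𝔽̄_p)[p] = 0` and a non-zero `p`-torsion point of the formal group has valuation `1/(p²−1)`, impossible in an
  abelian extension of `ℚ_p`, whose ramification index divides `(p−1)pⁿ`); (c) snake lemma. (At an ORDINARY prime (b) fails at `v̄` — anomalous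
  term — and only "kernel `ℤ_p`-finitely generated, hence `Λ_ac`-torsion" survives; that weaker form also suffices for the composition below.)
  Print shape: Greenberg LNM 1716 §3 (control), Skinner–Urban 2014 Prop. 3.2.8 (injectivity half), Iovita–Pollack / Kobayashi (`E(K_{∞,w})[p^∞] = 0` at ss `p`).

COMPOSITION `torsionSS_of` (kernel-checked, no sorry): f.g. of `X_Gr₂` over `Λ₂` is the tree theorem
`SignedBaseChangeAcDivFinitePiece.xGr₂_module_finite` (p610206); `X_ac` torsion + exact control ⇒ `X_Gr₂/T₁X_Gr₂` is torsion for the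
constants structure `Module.compHom _ PowerSeries.C` (encoding rule R2(a) of TYPING-BRIEF-S2-SPEC v1.3) ⇒ killing element `s`, `s(0) ≠ 0`
(`S2.exists_constantCoeff_ne_zero_of_isTorsion`, p564681) ⇒ `Λ₂`-torsion.
-/

open scoped Pointwise

namespace Summit.BirchSwinnertonDyer.BirchSwinnertonDyer.Cruxes.AnticyclotomicEisensteinDivisibility.Torsplice

open Summit.BirchSwinnertonDyer.BirchSwinnertonDyer.Theses.SignedBaseChange
open Literature.NumberTheory.EllipticCurves

/-- stub TS1 (ARITHMETIC INPUT, one variable; REFEREED PRINT for any `N⁺` under classical Heegner: Castella–Wan 2024 Lemma 5.11 + Thm 5.12): **`X_ac(E/K_∞⁻)` (v-relaxed, v̄-unramified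
dual Selmer over the anticyclotomic `ℤ_p`-tower) is `Λ_ac`-torsion** at a good supersingular `p ≥ 5`, `Surj`, classical Heegner `K`.
Sources: Castella–Wan Math. Ann. 389 (2024) §5.4 Thm 5.12 / Thm 4.3 (proof); CCSS arXiv:1804.10993 Lemma 5.5 + Thm 5.7 (PRE);
Kobayashi–Ota ASPM 86 (2020) (acq-07292). Text = the torsion hypothesis clause of `Bdpline.stub_bdpLowerHalfExistsSS` (v8) verbatim. -/
theorem stub_xAcTorsionSS :
    SignedTwoVariableInputs → Literature.NumberTheory.EllipticCurves.ModularForms.nonempty_modularParametrizationData → ∀ (W : WeierstrassCurve ℚ) [W.IsElliptic] [W.IsGloballyMinimal] (p : ℕ) [Fact p.Prime], 5 ≤ p → W.HasGoodReductionAtPrime p → W.frobeniusTrace p = 0 → Literature.NumberTheory.EllipticCurves.Rank1Residual.Surj W p → ∀ (K : Type) [Field K] [NumberField K] (ι : PadicAlgCl p ≃+* ℂ) (v vbar : IsDedekindDomain.HeightOneSpectrum (NumberField.RingOfIntegers K)) (κ₁ κ₂ : Literature.NumberTheory.EllipticCurves.ZpExtension K p) (γ₁ γ₂ : Field.absoluteGaloisGroup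 K) [Fact (Literature.NumberTheory.EllipticCurves.ZpExtension.IsTopGeneratorPair κ₁ κ₂ γ₁ γ₂)] [NeZero (NumberField.discr K).natAbs] (N : ℕ) [NeZero N] (f : CuspForm (CongruenceSubgroup.Gamma0 N) 2), Literature.NumberTheory.EllipticCurves.ModularForms.IsNewformOf W f → (N : ℤ) = W.conductorNorm ℤ → Literature.NumberTheory.EllipticCurves.IsImaginaryQuadratic K → ((Ideal.span {(p : ℤ)}).primesOver (NumberField.RingOfIntegers K)).ncard = 2 → ((p : ℕ) : NumberField.RingOfIntegers K) ∈ v.asIdeal → ((p : ℕ) : NumberField.RingOfIntegers K) ∈ vbar.asIdeal → vbar ≠ v → (∀ (w : NumberField.InfinitePlace K) (k : NumberField.RingOfIntegers K), k ∈ v.asIdeal ↔ ‖ι.symm (w.embedding (k : K))‖ < 1) → IsCoprime (N : ℤ) (NumberField.discr K) → (∀ ℓ : ℕ, ℓ.Prime → ℓ ∣ N → ((Ideal.span {(ℓ : ℤ)}).primesOver (NumberField.RingOfIntegers K)).ncard = 2) → Odd (NumberField.discr K) → NumberField.discr K ≠ -3 → κ₁.IsCyclotomic → κ₂.IsAnticyclotomic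 → (haveI : Fact (κ₂.IsTopGenerator γ₂) := ⟨Literature.NumberTheory.EllipticCurves.YanZhu2026.isTopGenerator_of_pair (κ₁ := κ₁) (γ₁ := γ₁)⟩; Module.IsTorsion (Literature.NumberTheory.EllipticCurves.IwasawaAlgebra p) (Literature.NumberTheory.EllipticCurves.Castella2018.AcSelmer.XAc (W.baseChange K) p κ₂ vbar ∅ γ₂)) := by
  sorry

/-- stub TS2 (GALOIS COHOMOLOGY, provable, L-sized): **exact anticyclotomic control at a supersingular prime** — the canonical
`Λ₂ → Λ_ac`-semilinear control map on the quotient, `toXAcQuot : X_Gr₂ ⧸ T₁ X_Gr₂ → X_ac` (tree; surjective by `toXAcQuot_surjective`),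
is INJECTIVE, i.e. `Sel_ac(E/K_∞⁻) → Sel(E/K̃_∞)^{γ₁ = 1}` is onto: `M^{H̃} = 0` kills the `H²` obstruction of inflation–restriction, the
inertia-type conditions at `w ∤ p` coincide (`K̃_∞/K_∞⁻` unramified outside `p`), no condition at `v`, and at `v̄` the local kernel is
`H¹(·, E[p^∞]^{H̃ ∩ I_v̄}) = 0` because a supersingular curve has no `p`-power torsion over `ℚ_p^{ab}·ℚ_p^{nr}`. (Ordinary `p`: false as
stated — anomalous kernel; the weaker "kernel `Λ_ac`-torsion" still holds and still suffices below.)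
PRINT SHAPE (refereed, sibling structure): Castella–Wan, Math. Ann. 389 (2024) = arXiv:1607.02019, proof of Thm. 6.1 (p.23, L107–116): «the natural restriction map H¹(K_∞^ac, E[p^∞]) → H¹(K_∞, E[p^∞]) induces a Λ_ac-module isomorphism 𝔛_𝔭(K,𝐀)/I^cyc 𝔛_𝔭(K,𝐀) ≃ 𝔛_𝔭(K,𝐀^ac)», 𝔛_𝔭 := 𝔛^{rel,str} = EXACTLY this (relaxed-at-𝔭, strict-at-𝔭̄) structure, ss p ≥ 5 split — the EXACT print match for TS2 (modulo the object dictionary); also proof of Cor. 4.4 (p.16): `𝔛^{ε,str}(K,𝐀)/I^{cyc}𝔛^{ε,str}(K,𝐀) ≃ 𝔛^{ε,str}(K,𝐀^{ac})` "as in [SU] with the roles of the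
cyclotomic and anticyclotomic ℤ_p-extensions reversed" (signed at 𝔭, strict at 𝔭̄, supersingular p > 3); our `X_Gr₂` is the (rel, str)-structure, whose 𝔭-part is trivially controlled.
Sources: Greenberg LNM 1716 §3; Skinner–Urban 2014 Prop. 3.2.8; Kobayashi 2003 / Iovita–Pollack 2006 (`E(K_{∞,w})[p^∞] = 0`). -/
theorem stub_exactControlSS :
    SignedTwoVariableInputs → Literature.NumberTheory.EllipticCurves.ModularForms.nonempty_modularParametrizationData → ∀ (W : WeierstrassCurve ℚ) [W.IsElliptic] [W.IsGloballyMinimal] (p : ℕ) [Fact p.Prime], 5 ≤ p → W.HasGoodReductionAtPrime p → W.frobeniusTrace p = 0 → Literature.NumberTheory.EllipticCurves.Rank1Residual.Surj W p → ∀ (K : Type) [Field K] [NumberField K] (ι : PadicAlgCl p ≃+* ℂ) (v vbar : IsDedekindDomain.HeightOneSpectrum (NumberField.RingOfIntegers K)) (κ₁ κ₂ : Literature.NumberTheory.EllipticCurves.ZpExtension K p) (γ₁ γ₂ : Field.absoluteGaloisGroup K) [Fact (Literature.NumberTheory.EllipticCurves.ZpExtension.IsTopGeneratorPair κ₁ κ₂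 γ₁ γ₂)] [NeZero (NumberField.discr K).natAbs] (N : ℕ) [NeZero N] (f : CuspForm (CongruenceSubgroup.Gamma0 N) 2), Literature.NumberTheory.EllipticCurves.ModularForms.IsNewformOf W f → (N : ℤ) = W.conductorNorm ℤ → Literature.NumberTheory.EllipticCurves.IsImaginaryQuadratic K → ((Ideal.span {(p : ℤ)}).primesOver (NumberField.RingOfIntegers K)).ncard = 2 → ((p : ℕ) : NumberField.RingOfIntegers K) ∈ v.asIdeal → ((p : ℕ) : NumberField.RingOfIntegers K) ∈ vbar.asIdeal → vbar ≠ v → (∀ (w : NumberField.InfinitePlace K) (k : NumberField.RingOfIntegers K), k ∈ v.asIdeal ↔ ‖ι.symm (w.embedding (k : K))‖ < 1) → IsCoprime (N : ℤ) (NumberField.discr K) → (∀ ℓ : ℕ, ℓ.Prime → ℓ ∣ N → ((Ideal.span {(ℓ : ℤ)}).primesOver (NumberField.RingOfIntegers K)).ncard = 2) → Odd (NumberField.discr K) → NumberField.discr K ≠ -3 → κ₁.IsCyclotomic → κ₂.IsAnticyclotomic → (haveI : Fact (κ₂.IsTopGenerator γ₂) := ⟨Literature.NumberTheory.EllipticCurves.YanZhu2026.isTopGenerator_of_pair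 (κ₁ := κ₁) (γ₁ := γ₁)⟩; Function.Injective (WeierstrassCurve.XGr₂.toXAcQuot (W.baseChange K) p κ₁ κ₂ vbar γ₁ γ₂)) := by
  sorry

/-- **COMPOSITION (kernel-checked): TS1 → TS2 → the TEXT of `Bdpline.stub_torsionSS` (v8) verbatim** — `X_Gr₂` is `Λ₂`-torsion at a good
supersingular prime. Uses the tree theorems `SignedBaseChangeAcDivFinitePiece.xGr₂_module_finite` (p610206, f.g.),
`SignedBaseChangeAcDivSpecialization.S2.exists_constantCoeff_ne_zero_of_isTorsion` (p564681, determinant trick) and `XGr₂.toXAcQuot` API. -/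
theorem torsionSS_of :
    (SignedTwoVariableInputs → Literature.NumberTheory.EllipticCurves.ModularForms.nonempty_modularParametrizationData → ∀ (W : WeierstrassCurve ℚ) [W.IsElliptic] [W.IsGloballyMinimal] (p : ℕ) [Fact p.Prime], 5 ≤ p → W.HasGoodReductionAtPrime p → W.frobeniusTrace p = 0 → Literature.NumberTheory.EllipticCurves.Rank1Residual.Surj W p → ∀ (K : Type) [Field K] [NumberField K] (ι : PadicAlgCl p ≃+* ℂ) (v vbar : IsDedekindDomain.HeightOneSpectrum (NumberField.RingOfIntegers K)) (κ₁ κ₂ : Literature.NumberTheory.EllipticCurves.ZpExtension K p) (γ₁ γ₂ : Field.absoluteGaloisGroup K) [Fact (Literature.NumberTheory.EllipticCurves.ZpExtension.IsTopGeneratorPair κ₁ κ₂ γ₁ γ₂)] [NeZero (NumberField.discr K).natAbs] (N : ℕ) [NeZero N] (f : CuspForm (CongruenceSubgroup.Gamma0 N) 2), Literature.NumberTheory.EllipticCurves.ModularForms.IsNewformOf W f → (N : ℤ) = W.conductorNorm ℤ → Literature.NumberTheory.EllipticCurves.IsImaginaryQuadratic K → ((Ideal.span {(p : ℤ)}).primesOver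 (NumberField.RingOfIntegers K)).ncard = 2 → ((p : ℕ) : NumberField.RingOfIntegers K) ∈ v.asIdeal → ((p : ℕ) : NumberField.RingOfIntegers K) ∈ vbar.asIdeal → vbar ≠ v → (∀ (w : NumberField.InfinitePlace K) (k : NumberField.RingOfIntegers K), k ∈ v.asIdeal ↔ ‖ι.symm (w.embedding (k : K))‖ < 1) → IsCoprime (N : ℤ) (NumberField.discr K) → (∀ ℓ : ℕ, ℓ.Prime → ℓ ∣ N → ((Ideal.span {(ℓ : ℤ)}).primesOver (NumberField.RingOfIntegers K)).ncard = 2) → Odd (NumberField.discr K) → NumberField.discr K ≠ -3 → κ₁.IsCyclotomic → κ₂.IsAnticyclotomic → (haveI : Fact (κ₂.IsTopGenerator γ₂) := ⟨Literature.NumberTheory.EllipticCurves.YanZhu2026.isTopGenerator_of_pair (κ₁ := κ₁) (γ₁ := γ₁)⟩; Module.IsTorsion (Literature.NumberTheory.EllipticCurves.IwasawaAlgebra p) (Literature.NumberTheory.EllipticCurves.Castella2018.AcSelmer.XAc (W.baseChange K) p κ₂ vbar ∅ γ₂))) →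
    (SignedTwoVariableInputs → Literature.NumberTheory.EllipticCurves.ModularForms.nonempty_modularParametrizationData → ∀ (W : WeierstrassCurve ℚ) [W.IsElliptic] [W.IsGloballyMinimal] (p : ℕ) [Fact p.Prime], 5 ≤ p → W.HasGoodReductionAtPrime p → W.frobeniusTrace p = 0 → Literature.NumberTheory.EllipticCurves.Rank1Residual.Surj W p → ∀ (K : Type) [Field K] [NumberField K] (ι : PadicAlgCl p ≃+* ℂ) (v vbar : IsDedekindDomain.HeightOneSpectrum (NumberField.RingOfIntegers K)) (κ₁ κ₂ : Literature.NumberTheory.EllipticCurves.ZpExtension K p) (γ₁ γ₂ : Field.absoluteGaloisGroup K) [Fact (Literature.NumberTheory.EllipticCurves.ZpExtension.IsTopGeneratorPair κ₁ κ₂ γ₁ γ₂)] [NeZero (NumberField.discr K).natAbs] (N : ℕ) [NeZero N] (f : CuspForm (CongruenceSubgroup.Gamma0 N) 2), Literature.NumberTheory.EllipticCurves.ModularForms.IsNewformOf W f → (N : ℤ) = W.conductorNorm ℤ → Literature.NumberTheory.EllipticCurves.IsImaginaryQuadratic K → ((Ideal.span {(p : ℤ)}).primesOver (NumberField.RingOfIntegers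 K)).ncard = 2 → ((p : ℕ) : NumberField.RingOfIntegers K) ∈ v.asIdeal → ((p : ℕ) : NumberField.RingOfIntegers K) ∈ vbar.asIdeal → vbar ≠ v → (∀ (w : NumberField.InfinitePlace K) (k : NumberField.RingOfIntegers K), k ∈ v.asIdeal ↔ ‖ι.symm (w.embedding (k : K))‖ < 1) → IsCoprime (N : ℤ) (NumberField.discr K) → (∀ ℓ : ℕ, ℓ.Prime → ℓ ∣ N → ((Ideal.span {(ℓ : ℤ)}).primesOver (NumberField.RingOfIntegers K)).ncard = 2) → Odd (NumberField.discr K) → NumberField.discr K ≠ -3 → κ₁.IsCyclotomic → κ₂.IsAnticyclotomic → (haveI : Fact (κ₂.IsTopGenerator γ₂) := ⟨Literature.NumberTheory.EllipticCurves.YanZhu2026.isTopGenerator_of_pair (κ₁ := κ₁) (γ₁ := γ₁)⟩; Function.Injective (WeierstrassCurve.XGr₂.toXAcQuot (W.baseChange K) p κ₁ κ₂ vbar γ₁ γ₂))) →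
    (SignedTwoVariableInputs → Literature.NumberTheory.EllipticCurves.ModularForms.nonempty_modularParametrizationData → ∀ (W : WeierstrassCurve ℚ) [W.IsElliptic] [W.IsGloballyMinimal] (p : ℕ) [Fact p.Prime], 5 ≤ p → W.HasGoodReductionAtPrime p → W.frobeniusTrace p = 0 → Literature.NumberTheory.EllipticCurves.Rank1Residual.Surj W p → ∀ (K : Type) [Field K] [NumberField K] (ι : PadicAlgCl p ≃+* ℂ) (v vbar : IsDedekindDomain.HeightOneSpectrum (NumberField.RingOfIntegers K)) (κ₁ κ₂ : Literature.NumberTheory.EllipticCurves.ZpExtension K p) (γ₁ γ₂ : Field.absoluteGaloisGroup K) [Fact (Literature.NumberTheory.EllipticCurves.ZpExtension.IsTopGeneratorPair κ₁ κ₂ γ₁ γ₂)] [NeZero (NumberField.discr K).natAbs] (N : ℕ) [NeZero N] (f : CuspForm (CongruenceSubgroup.Gamma0 N) 2), Literature.NumberTheory.EllipticCurves.ModularForms.IsNewformOf W f → (N : ℤ) = W.conductorNorm ℤ → Literature.NumberTheory.EllipticCurves.IsImaginaryQuadratic K → ((Ideal.span {(p : ℤ)}).primesOver (NumberField.RingOfIntegers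 K)).ncard = 2 → ((p : ℕ) : NumberField.RingOfIntegers K) ∈ v.asIdeal → ((p : ℕ) : NumberField.RingOfIntegers K) ∈ vbar.asIdeal → vbar ≠ v → (∀ (w : NumberField.InfinitePlace K) (k : NumberField.RingOfIntegers K), k ∈ v.asIdeal ↔ ‖ι.symm (w.embedding (k : K))‖ < 1) → IsCoprime (N : ℤ) (NumberField.discr K) → (∀ ℓ : ℕ, ℓ.Prime → ℓ ∣ N → ((Ideal.span {(ℓ : ℤ)}).primesOver (NumberField.RingOfIntegers K)).ncard = 2) → Odd (NumberField.discr K) → NumberField.discr K ≠ -3 → κ₁.IsCyclotomic → κ₂.IsAnticyclotomic → Module.IsTorsion (Literature.NumberTheory.EllipticCurves.IwasawaAlgebra₂ p) ((W.baseChange K).XGr₂ p κ₁ κ₂ vbar γ₁ γ₂)) := by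
  intro h1 h2
  intro hIn hMP W _ _ p _ hp hgood hap hsurj K _ _ ι v vbar κ₁ κ₂ γ₁ γ₂ _ _ N _ f hf hN hK hsplit hv hvbar hne hιv hcop hHeeg hodd hm3 hcyc hac
  haveI hγ₂ : Fact (κ₂.IsTopGenerator γ₂) :=
    ⟨Literature.NumberTheory.EllipticCurves.YanZhu2026.isTopGenerator_of_pair (κ₁ := κ₁) (γ₁ := γ₁)⟩
  -- the two inputs at this frame
  have hT := h1 hIn hMP W p hp hgood hap hsurj K ι v vbar κ₁ κ₂ γ₁ γ₂ N f hf hN hK hsplit hv hvbar hne hιv hcop hHeeg hodd hm3 hcyc hac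
  have hC := h2 hIn hMP W p hp hgood hap hsurj K ι v vbar κ₁ κ₂ γ₁ γ₂ N f hf hN hK hsplit hv hvbar hne hιv hcop hHeeg hodd hm3 hcyc hac
  -- notation
  set X := (W.baseChange K).XGr₂ p κ₁ κ₂ vbar γ₁ γ₂ with hXdef
  -- f.g. over Λ₂ (tree theorem, p610206)
  haveI : Module.Finite (IwasawaAlgebra₂ p) X :=
    Summit.BirchSwinnertonDyer.BirchSwinnertonDyer.Theorems.SignedBaseChangeAcDivFinitePiece.xGr₂_module_finite
      (W.baseChange K) p κ₁ κ₂ vbar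
  -- killing element with non-zero constant term, from torsion of the quotient for the constants structure
  obtain ⟨s, hs0, hs⟩ :=
    Summit.BirchSwinnertonDyer.BirchSwinnertonDyer.Theorems.SignedBaseChangeAcDivSpecialization.S2.exists_constantCoeff_ne_zero_of_isTorsion
      p X (by
        letI : Module (IwasawaAlgebra p) (QuotSMulTop (PowerSeries.X : PowerSeries (IwasawaAlgebra p)) X) :=
          Module.compHom _ (PowerSeries.C (R := IwasawaAlgebra p))
        intro q
        obtain ⟨x, rfl⟩ := Submodule.Quotient.mk_surjective _ q
        -- X_ac is torsion: a non-zero-divisor g kills the image of x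
        obtain ⟨⟨g, hg⟩, hgx⟩ := @hT (WeierstrassCurve.XGr₂.toXAc (W.baseChange K) p κ₁ κ₂ vbar γ₁ γ₂ x)
        refine ⟨⟨g, hg⟩, ?_⟩
        -- `g • q` for the compHom structure is `C g • q`
        show (PowerSeries.C (R := IwasawaAlgebra p) g : PowerSeries (IwasawaAlgebra p)) •
            (Submodule.Quotient.mk x : QuotSMulTop (PowerSeries.X : PowerSeries (IwasawaAlgebra p)) X) = 0
        rw [← Submodule.Quotient.mk_smul, Submodule.Quotient.mk_eq_zero]
        -- `C g • x` lies in the kernel of the control map, hence (exact control) in `T₁ • X`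
        have hker : WeierstrassCurve.XGr₂.toXAc (W.baseChange K) p κ₁ κ₂ vbar γ₁ γ₂
            ((PowerSeries.C g : IwasawaAlgebra₂ p) • x) = 0 := by
          rw [WeierstrassCurve.XGr₂.toXAc_C_smul]
          simpa using hgx
        have hq0 : (Submodule.Quotient.mk ((PowerSeries.C g : IwasawaAlgebra₂ p) • x) :
            X ⧸ (Ideal.span {(PowerSeries.X : IwasawaAlgebra₂ p)} • (⊤ : Submodule (IwasawaAlgebra₂ p) X))) = 0 := by
          apply hC
          rw [map_zero, WeierstrassCurve.XGr₂.toXAcQuot_mk, hker]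
        rw [Submodule.Quotient.mk_eq_zero, Submodule.ideal_span_singleton_smul] at hq0
        exact hq0)
  -- conclude Λ₂-torsion
  have hsne : s ≠ 0 := fun h => hs0 (by rw [h, map_zero])
  exact fun x => ⟨⟨s, mem_nonZeroDivisors_of_ne_zero hsne⟩, hs x⟩

end Summit.BirchSwinnertonDyer.BirchSwinnertonDyer.Cruxes.AnticyclotomicEisensteinDivisibility.Torsplice
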